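import Summits.QuantumFields.BalabanUV.T4Continuum.Support.ShellMeasureRealFormDet
import Summits.QuantumFields.BalabanUV.T4Continuum.Support.ShellMeasureLinearizedRealForm
import Summits.QuantumFields.BalabanUV.T4Continuum.Support.ShellMeasureRayWiring

/-!
# `T4Continuum.ShellMeasureLinearizedJacobian` — (LR)_j: THE JACOBIAN OF PRINT'S LINEARIZING SUBSTITUTION, READ ON
# THE REAL FORM, IS AN SM-L4-TYPE TERM — `det Φ'_ℝ = Re det_ℂ DΦ > 0 = exp (Re Tr log DΦ)`, and E2′'s ray binder
# `hE` for the term `𝓔_J := −Re Tr log DΦ` holds with an explicit constant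
(cell `pub-balaban`, sub-cell `t4`, spine estimate NE7c (node U5b); NE7c ROUND-2 crew seat
`b2b-balaban-t4-ne7c-formalise-leaf-02` gen 6 — idle-seat OFFER in the (LR)_j ∕ LZ orbit (journal `CLAIMS.log`), file
2 of 2; ADDITIVE — imports file 1 `ShellMeasureRealFormDet`, gen 5's `ShellMeasureLinearizedRealForm` (p216819) and
S16 `ShellMeasureRayWiring` (p208639) only, modifies nothing; [folklore] over tree theorems BY NAME; 0 `def`,
0 `def … : Prop`, 0 sorry, 0 citations — equation numbers LOCATE displayed shapes)

HONEST FRAMING.  Finite four-torus programme, rung (B)+1 only — NOT infinite volume, NOT a mass gap, NOT the Clay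
problem, NOT summit progress; (B), `BetaPertHyp`, (B^μ) not consumed.  NE7c (`T4IndicatorShell.ShellWeightBound`) is
NOT PRINTED and NOT PROVED; «NE7c ⇐ the named binders» (trigger c3).  Nothing of [Balaban 1983–89] is asserted:
print's substitution `B′ = B − hD̃(B)` ([Balaban1987RG1] p. 267) and its Jacobian term «Tr log(I − h((δ∕δB)D̃)(g_kCB))»
((2.12) p. 268) enter ONLY through the tree leaves `B12Lineariz267` ∕ `B12LinearizAnalytic267` ∕ `B12JacobianTrLog268`
∕ `B12JacobianReal267` BY NAME (`fderiv_phi`, `fderiv_Dt_real`, `fderiv_phi_real`, `det_jacobian_pos`,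
`cexp_trace_logJacobian_eq_det_fderiv_phi`, `analyticOnNhd_trace_logJacobian`, `norm_trace_logJacobian_le_finrank`),
whose every analytic input (`C̃` quadratic-analytic, `h`, `D̃` hypothesis-style with its ball and fixed-point
properties — any `D̃` of `B12Lineariz267.exists_Dt` —, the conjugations and their equivariance, `9C₂bε ≤ 1∕2`,
`3ε ≤ R`) stays a displayed-TYPE binder, as does the real form `(ιE, πE, ιF, πF)` of `ShellMeasureLinearizedRealForm`
(+ `hπιE : πE ∘ ιE = id`) and a real `h : F →L[ℝ] E` intertwined with print's `h` (`hh : hop (ιF x) = ιE (h x)` —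
satisfied by that file's `πE ∘ hop ∘ ιF`, `hop_ιF_realForm`, and by the intertwined `h` of the owner's
`ShellMeasureLinearizedReal`).  HONEST DEPENDENCY (cell, verbatim): continuum YM on T⁴ ⇐ BetaPertH ∧ nine spine
estimates (0/9 proved); BetaPertH ⇐ (D1) ∧ (D4) ∧ CAP+tail; G-an2-4 gates asym, D1 and NE2/3/4.

THE GAP IT CLOSES.  S33 `ShellMeasureLinearizedChart` (leaf-09-g7) charts the (LR)_j fibre by a curved chart `Φ` and
pulls the block's Lebesgue law back with the Jacobian `ENNReal.ofReal |(Φ' y).det|`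
(`map_withDensity_jacobian`, Mathlib's `lintegral_image_eq_lintegral_abs_det_fderiv_mul`); its header and GAPS
G-ne7cleaf09-22 record: «The Jacobian `|det Φ'|` rides INSIDE the density — it is print's (2.12) term; its share of
SM-L4's ray bound is NOT claimed».  For print's substitution read on the real form (`ShellMeasureLinearizedRealForm`
§3–§4: real chart `B ↦ B − h (D̃_ℝ B)` with derivative `id − h ∘ (πF ∘ DD̃(ιE B)↾ℝ ∘ ιE)` within the real window
`‖ιE B‖ < ε`) THIS FILE CLAIMS IT:
* §1 `realForm_fderiv_phi`: that derivative IS `πE ∘ DΦ(ιE B)↾ℝ ∘ ιE`, `DΦ = 1 − h∘DD̃`; hence (file 1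
  `det_realForm`) **`det Φ'_ℝ(B) = det_ℂ DΦ(ιE B)`** (`det_realForm_phi`), **positive** (`det_realForm_phi_pos`,
  `9C₂bε ≤ 1∕2`) and **`= exp (Re Tr mlog(1 − J(ιE B)))`**, `J = h∘DD̃` (`det_realForm_phi_eq_exp`): the Jacobian
  factor IS `e^{−𝓔_J}` with the non-Wilson-TYPE term `𝓔_J := −Re Tr log DΦ ∘ ιE`, i.e. it rides in E2′'s `weight`
  (`ShellMeasureLevelAssembly.weight … 𝓔 = ofReal (exp (−(… + 𝓔)))`) as ONE MORE term — the dictionary `hFdict` of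
  S33's ENDs can book it there; a non-vacuity `example` inhabits the binder shapes (B12's degenerate model, `E = ℝ`).
* §2 THE SM-L4 PAIR of the Jacobian term along an affine real ray `y₀ + c • v` (in S33's END: `y₀ = σ b` the fibre
  chart's centre, `v = Ψ (x, 0)`): `w ↦ Tr mlog(1 − J(ιE y₀ + w • ιE v))` is complex differentiable on `‖w‖ < Rad`
  whenever `‖ιE y₀‖ + Rad·‖ιE v‖ ≤ r < ε` (`differentiableOn_jacobianTerm_ray`), with SUP bound
  `dim_ℂ 𝒴 · (−log(1 − 18C₂b·r))` (`norm_jacobianTerm_ray_le`), oscillation twice that (`osc_jacobianTerm_ray_le`),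
  and REAL PART `log det Φ'_ℝ(y₀ + c • v)` at real `c` (`re_jacobianTerm_ray`) — EXACTLY the per-term input
  `(hg, hosc, hreal)` of S16 `ShellMeasureRayWiring.rayBound_of_analytic_terms`.
* §3 THE END SHAPE `hE_jacobianTerm`: in the fibre coordinate `x : Kf` (charted point `y₀ + Λ x`, `Λ` real-linear),
  for `x ∈ W` with `‖ιE y₀‖ + Rad·‖ιE (Λ x)‖ ≤ r < ε`, `Rad > 1`, and `1∕2 ≤ c ≤ 1`:
  `𝓔_J (c • x) ≤ 𝓔_J x + (1 − c)·(3·(2·dim_ℂ 𝒴·(−log(1 − 18C₂b·r)))∕(Rad − 1))` — LITERALLY E2′'s binder `hE`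
  (`ShellMeasureLevelAssembly.slotAntiConcentration_of_levelData` ∕ S33 `slotAC_linearizedWindow_of_levelData`) for this
  term, by ONE call of S16 `rayBound_of_analytic`; `hB𝓔_jacobianTerm` the constant's sign.
CONSEQUENCE FOR THE LEDGER (c3-honest).  On the (LR)_j road the Jacobian's share of W-b (SM-L4) is RE-SOURCED to W-d's
OWN data (`LQ̃h = I`, `C̃` quadratic-analytic in the contraction regime and real on real fields, finite dimension) —
NO new binder, nothing minted (c2).  WHAT STAYS DISPLAYED: print's claim that the block average about the step's
background IS `LQ̃ + C̃` (B12 p. 267 TYPE, node-U0∕U5d typing); the SM-L4 pairs of Bałaban's OTHER terms (W-b proper),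
the dictionary (W-c), (MR)_j (W-e); the supplier's check that the window's complexified fibre rays satisfy
`‖ιE σ b‖ + Rad·‖ιE Ψ(x,0)‖ ≤ r < ε`.  NOT an instance of SM-L1…L6 for Bałaban's measures; NOTHING in the countdown
moves; NE7c NOT PROVED; spine PROVED 0/9.
-/

noncomputable section

open Set Metric Filter Topology

namespace Summit.QuantumFields.BalabanUV.T4Continuum.ShellMeasureLinearizedJacobian

open Literature.MathematicalPhysics.QuantumFieldTheory.Balaban1983to89
open B13Contraction113 (QuadAnalytic)
open B12JacobianReal267 (fderiv_Dt_real fderiv_phi_real det_jacobian_pos)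
open B12JacobianTrLog268 (fderiv_phi lt_one_of_le_half eighteen_lt_one cexp_trace_logJacobian_eq_det_fderiv_phi
  analyticOnNhd_trace_logJacobian norm_trace_logJacobian_le_finrank)
open MatrixLog (mlog)
open ShellMeasureLinearizedRealForm (hop_real)
open ShellMeasureRealFormDet (det_realForm)

/-! ## §1 The real Jacobian of the real substitution IS `det_ℂ DΦ`: positive, `= exp (Re Tr log DΦ)` -/

section RealJacobian

variable {𝒳 𝒴 : Type*} [NormedAddCommGroup 𝒳] [NormedSpace ℂ 𝒳] [CompleteSpace 𝒳]
  [NormedAddCommGroup 𝒴] [NormedSpace ℂ 𝒴] [CompleteSpace 𝒴]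
  {hop : 𝒳 →ₗ[ℂ] 𝒴} {Ct : 𝒴 → 𝒳} {C₂ R b ε : ℝ} {Dt : 𝒴 → 𝒳}
  {κX : 𝒳 ≃ₗᵢ⋆[ℂ] 𝒳} {κY : 𝒴 ≃ₗᵢ⋆[ℂ] 𝒴}
variable {E F : Type*} [NormedAddCommGroup E] [NormedSpace ℝ E] [NormedAddCommGroup F] [NormedSpace ℝ F]
  {ιE : E →L[ℝ] 𝒴} {πE : 𝒴 →L[ℝ] E} {ιF : F →L[ℝ] 𝒳} {πF : 𝒳 →L[ℝ] F} {h : F →L[ℝ] E}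

omit [CompleteSpace 𝒳] [CompleteSpace 𝒴] in
/-- **THE INTERTWINING `hop ∘ ιF = ιE ∘ h` HOLDS FOR THE REAL-FORM `h := πE ∘ hop ∘ ιF`** of
`ShellMeasureLinearizedRealForm` (so everything below applies to that file's real chart; it also covers an abstract
real `h` intertwined with `hop`, the typing of the owner's `ShellMeasureLinearizedReal`). [folklore] -/
theorem hop_ιF_realForm (hHop : ∀ X, ‖hop X‖ ≤ b * ‖X‖) (hhop : ∀ X, hop (κX X) = κY (hop X))
    (hιπE : ∀ B, κY B = B → ιE (πE B) = B) (hιFr : ∀ x, κX (ιF x) = ιF x) (x : F) :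
    hop (ιF x) = ιE ((πE ∘L (hop.mkContinuous b hHop).restrictScalars ℝ ∘L ιF) x) := by
  simp only [ContinuousLinearMap.coe_comp, Function.comp_apply, ContinuousLinearMap.coe_restrictScalars',
    LinearMap.mkContinuous_apply]
  rw [hιπE _ (hop_real hhop (hιFr x))]

/-- **THE DERIVATIVE OF THE REAL SUBSTITUTION IS `DΦ` READ ON THE REAL FORM.**  At a point `B` of the real window
(`‖ιE B‖ < ε`), the derivative `id − h ∘ (πF ∘ DD̃(ιE B)↾ℝ ∘ ιE)` of the real chart `B ↦ B − h (D̃_ℝ B)`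
(`ShellMeasureLinearizedConstraint.substitution_hasFDerivWithinAt` ∕ `ShellMeasureLinearizedRealForm.realForm_chartData`
(iii) ∕ the owner's `ShellMeasureLinearizedReal.hasFDerivWithinAt_real_substitution`, whose `DD̃` is written out —
rewrite with `B12LinearizAnalytic267.fderiv_Dt`) EQUALS
`πE ∘ DΦ(ιE B)↾ℝ ∘ ιE`, `DΦ = 1 − h∘DD̃` (`B12JacobianTrLog268.fderiv_phi`), because `DD̃(ιE B)` maps real vectors
to real vectors (`B12JacobianReal267.fderiv_Dt_real`) and `h` is `hop` on them (`hh`). [folklore] -/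
theorem realForm_fderiv_phi (hC : QuadAnalytic Ct C₂ R) (hCa : AnalyticOnNhd ℂ Ct {Y : 𝒴 | ‖Y‖ < R})
    (hC₂ : 0 ≤ C₂) (hb : 0 ≤ b) (hHop : ∀ X, ‖hop X‖ ≤ b * ‖X‖) (hq : 9 * C₂ * b * ε < 1)
    (hRC : 3 * ε ≤ R) (hDball : ∀ B : 𝒴, ‖B‖ < ε → Dt B ∈ closedBall (0:𝒳) (4 * C₂ * ε ^ 2))
    (hDfix : ∀ B : 𝒴, ‖B‖ < ε → Ct (B - hop (Dt B)) = Dt B)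
    (hκX : ∀ X, κX (κX X) = X) (hκY : ∀ B, κY (κY B) = B)
    (hhop : ∀ X, hop (κX X) = κY (hop X)) (hCt : ∀ Y : 𝒴, ‖Y‖ < R → Ct (κY Y) = κX (Ct Y))
    (hιEr : ∀ y, κY (ιE y) = ιE y) (hπιE : ∀ y, πE (ιE y) = y)
    (hιπF : ∀ X, κX X = X → ιF (πF X) = X) (hh : ∀ x, hop (ιF x) = ιE (h x))
    {B : E} (hB : ‖ιE B‖ < ε) :
    ContinuousLinearMap.id ℝ E - h ∘L (πF ∘L (fderiv ℂ Dt (ιE B)).restrictScalars ℝ ∘L ιE) =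
      πE ∘L (fderiv ℂ (fun B => B - hop (Dt B)) (ιE B)).restrictScalars ℝ ∘L ιE := by
  ext y
  have hreal : κX (fderiv ℂ Dt (ιE B) (ιE y)) = fderiv ℂ Dt (ιE B) (ιE y) := by
    have e := fderiv_Dt_real hC hCa hC₂ hb hHop hq hRC hDball hDfix hκX hκY hhop hCt hB (hιEr B) (ιE y)
    rw [hιEr] at e
    exact e.symm
  have hπh : πE (hop (fderiv ℂ Dt (ιE B) (ιE y))) = h (πF (fderiv ℂ Dt (ιE B) (ιE y))) := by
    conv_lhs => rw [← hιπF _ hreal, hh, hπιE]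
  rw [fderiv_phi hC hCa hC₂ hb hHop hq hRC hDball hDfix hB]
  simp only [sub_apply, ContinuousLinearMap.coe_id', id, ContinuousLinearMap.coe_comp, Function.comp_apply,
    ContinuousLinearMap.coe_restrictScalars', one_apply_eq_self, LinearMap.mkContinuous_apply, map_sub, hπιE, hπh]

variable [FiniteDimensional ℂ 𝒴]

/-- **THE REAL JACOBIAN DETERMINANT IS THE COMPLEX ONE**: `det_ℝ (id − h ∘ D̃'_ℝ(B)) = det_ℂ DΦ(ιE B)` (as a
complex number; `DΦ(ιE B)` commutes with the conjugation at the real point `ιE B`,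
`B12JacobianReal267.fderiv_phi_real`, and file 1 `ShellMeasureRealFormDet.det_realForm`). [folklore] -/
theorem det_realForm_phi (hC : QuadAnalytic Ct C₂ R) (hCa : AnalyticOnNhd ℂ Ct {Y : 𝒴 | ‖Y‖ < R})
    (hC₂ : 0 ≤ C₂) (hb : 0 ≤ b) (hHop : ∀ X, ‖hop X‖ ≤ b * ‖X‖) (hq : 9 * C₂ * b * ε < 1)
    (hRC : 3 * ε ≤ R) (hDball : ∀ B : 𝒴, ‖B‖ < ε → Dt B ∈ closedBall (0:𝒳) (4 * C₂ * ε ^ 2))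
    (hDfix : ∀ B : 𝒴, ‖B‖ < ε → Ct (B - hop (Dt B)) = Dt B)
    (hκX : ∀ X, κX (κX X) = X) (hκY : ∀ B, κY (κY B) = B)
    (hhop : ∀ X, hop (κX X) = κY (hop X)) (hCt : ∀ Y : 𝒴, ‖Y‖ < R → Ct (κY Y) = κX (Ct Y))
    (hιπE : ∀ B, κY B = B → ιE (πE B) = B) (hιEr : ∀ y, κY (ιE y) = ιE y) (hπιE : ∀ y, πE (ιE y) = y)
    (hιπF : ∀ X, κX X = X → ιF (πF X) = X) (hh : ∀ x, hop (ιF x) = ιE (h x))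
    {B : E} (hB : ‖ιE B‖ < ε) :
    (((ContinuousLinearMap.id ℝ E - h ∘L (πF ∘L (fderiv ℂ Dt (ιE B)).restrictScalars ℝ ∘L ιE)).det : ℝ) : ℂ) =
      LinearMap.det ((fderiv ℂ (fun B => B - hop (Dt B)) (ιE B) : 𝒴 →L[ℂ] 𝒴) : 𝒴 →ₗ[ℂ] 𝒴) := by
  rw [realForm_fderiv_phi hC hCa hC₂ hb hHop hq hRC hDball hDfix hκX hκY hhop hCt hιEr hπιE hιπF hh hB]
  exact det_realForm hκY hιπE hιEr hπιE _
    (fderiv_phi_real hC hCa hC₂ hb hHop hq hRC hDball hDfix hκX hκY hhop hCt hB (hιEr B))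

/-- **THE REAL JACOBIAN IS POSITIVE** on the real window (`9C₂bε ≤ 1∕2`): `0 < det (id − h ∘ D̃'_ℝ(B))`
(`B12JacobianReal267.det_jacobian_pos`, connectedness of the real ball). [folklore] -/
theorem det_realForm_phi_pos (hC : QuadAnalytic Ct C₂ R) (hCa : AnalyticOnNhd ℂ Ct {Y : 𝒴 | ‖Y‖ < R})
    (hC₂ : 0 ≤ C₂) (hb : 0 ≤ b) (hHop : ∀ X, ‖hop X‖ ≤ b * ‖X‖) (hq2 : 9 * C₂ * b * ε ≤ 1 / 2)
    (hRC : 3 * ε ≤ R) (hDball : ∀ B : 𝒴, ‖B‖ < ε → Dt B ∈ closedBall (0:𝒳) (4 * C₂ * ε ^ 2))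
    (hDfix : ∀ B : 𝒴, ‖B‖ < ε → Ct (B - hop (Dt B)) = Dt B)
    (hκX : ∀ X, κX (κX X) = X) (hκY : ∀ B, κY (κY B) = B)
    (hhop : ∀ X, hop (κX X) = κY (hop X)) (hCt : ∀ Y : 𝒴, ‖Y‖ < R → Ct (κY Y) = κX (Ct Y))
    (hιπE : ∀ B, κY B = B → ιE (πE B) = B) (hιEr : ∀ y, κY (ιE y) = ιE y) (hπιE : ∀ y, πE (ιE y) = y)
    (hιπF : ∀ X, κX X = X → ιF (πF X) = X) (hh : ∀ x, hop (ιF x) = ιE (h x))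
    {B : E} (hB : ‖ιE B‖ < ε) :
    0 < (ContinuousLinearMap.id ℝ E - h ∘L (πF ∘L (fderiv ℂ Dt (ιE B)).restrictScalars ℝ ∘L ιE)).det := by
  have e := det_realForm_phi hC hCa hC₂ hb hHop (lt_one_of_le_half hq2) hRC hDball hDfix hκX hκY hhop hCt hιπE
    hιEr hπιE hιπF hh hB
  have hpos := det_jacobian_pos hC hCa hC₂ hb hHop hq2 hRC hDball hDfix hκX hκY hhop hCt hB (hιEr B)
  rw [← e, Complex.ofReal_re] at hpos
  exact hpos

/-- **THE REAL JACOBIAN IS `exp (Re Tr log DΦ)`**: `det (id − h ∘ D̃'_ℝ(B)) = exp (Re Tr mlog(1 − J(ιE B)))`,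
`J = h∘DD̃` — the factor `|det Φ'|` of the change of variables (S33 `ShellMeasureLinearizedChart.map_withDensity_jacobian`)
IS `e^{−𝓔_J}` with the non-Wilson-type term `𝓔_J := −Re Tr log DΦ ∘ ιE` of print's (2.12)
(`B12JacobianTrLog268.cexp_trace_logJacobian_eq_det_fderiv_phi` BY NAME). [folklore] -/
theorem det_realForm_phi_eq_exp (hC : QuadAnalytic Ct C₂ R) (hCa : AnalyticOnNhd ℂ Ct {Y : 𝒴 | ‖Y‖ < R})
    (hC₂ : 0 ≤ C₂) (hb : 0 ≤ b) (hHop : ∀ X, ‖hop X‖ ≤ b * ‖X‖) (hq2 : 9 * C₂ * b * ε ≤ 1 / 2)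
    (hRC : 3 * ε ≤ R) (hDball : ∀ B : 𝒴, ‖B‖ < ε → Dt B ∈ closedBall (0:𝒳) (4 * C₂ * ε ^ 2))
    (hDfix : ∀ B : 𝒴, ‖B‖ < ε → Ct (B - hop (Dt B)) = Dt B)
    (hκX : ∀ X, κX (κX X) = X) (hκY : ∀ B, κY (κY B) = B)
    (hhop : ∀ X, hop (κX X) = κY (hop X)) (hCt : ∀ Y : 𝒴, ‖Y‖ < R → Ct (κY Y) = κX (Ct Y))
    (hιπE : ∀ B, κY B = B → ιE (πE B) = B) (hιEr : ∀ y, κY (ιE y) = ιE y) (hπιE : ∀ y, πE (ιE y) = y)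
    (hιπF : ∀ X, κX X = X → ιF (πF X) = X) (hh : ∀ x, hop (ιF x) = ιE (h x))
    {B : E} (hB : ‖ιE B‖ < ε) :
    (ContinuousLinearMap.id ℝ E - h ∘L (πF ∘L (fderiv ℂ Dt (ιE B)).restrictScalars ℝ ∘L ιE)).det =
      Real.exp (LinearMap.trace ℂ 𝒴
        ((mlog (1 - hop.mkContinuous b hHop ∘L fderiv ℂ Dt (ιE B)) : 𝒴 →L[ℂ] 𝒴) : 𝒴 →ₗ[ℂ] 𝒴)).re := by
  have e1 := cexp_trace_logJacobian_eq_det_fderiv_phi hC hCa hC₂ hb hHop hq2 hRC hDball hDfix hB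
  have e2 := det_realForm_phi hC hCa hC₂ hb hHop (lt_one_of_le_half hq2) hRC hDball hDfix hκX hκY hhop hCt hιπE
    hιEr hπιE hιπF hh hB
  have hpos := det_realForm_phi_pos hC hCa hC₂ hb hHop hq2 hRC hDball hDfix hκX hκY hhop hCt hιπE hιEr hπιE
    hιπF hh hB
  have h3 : Real.exp (LinearMap.trace ℂ 𝒴
      ((mlog (1 - hop.mkContinuous b hHop ∘L fderiv ℂ Dt (ιE B)) : 𝒴 →L[ℂ] 𝒴) : 𝒴 →ₗ[ℂ] 𝒴)).re =
      |(ContinuousLinearMap.id ℝ E - h ∘L (πF ∘L (fderiv ℂ Dt (ιE B)).restrictScalars ℝ ∘L ιE)).det| := by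
    rw [← Complex.norm_exp, e1, ← e2, Complex.norm_real, Real.norm_eq_abs]
  rw [h3, abs_of_pos hpos]

/-- NON-VACUITY of the binder SHAPES of §1 (jointly inhabited; shapes only): the degenerate model of
`B12JacobianReal267` (`𝒳 = 𝒴 = ℂ`, `κ` = complex conjugation, `h = id`, `C̃ = 0`, `D̃ = 0`, `C₂ = 0`, `R = 3`,
`b = 1`, `ε = 1`) with the real form `E = F = ℝ`, `ιE = ιF` = the inclusion `ℝ → ℂ`, `πE = πF = Re`, real `h = id`;
the real Jacobian at the real point `B = 1/2` is positive (it is `1`). -/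
example : 0 < (ContinuousLinearMap.id ℝ ℝ - (ContinuousLinearMap.id ℝ ℝ) ∘L (Complex.reCLM ∘L
    (fderiv ℂ (fun _ : ℂ => (0:ℂ)) (Complex.ofRealCLM ((1:ℝ) / 2))).restrictScalars ℝ ∘L Complex.ofRealCLM)).det :=
  det_realForm_phi_pos (hop := LinearMap.id) (Ct := fun _ => 0) (C₂ := 0) (R := 3) (b := 1) (ε := 1)
    (Dt := fun _ => 0) (κX := starₗᵢ ℂ) (κY := starₗᵢ ℂ) (πE := Complex.reCLM) (ιF := Complex.ofRealCLM)
    ⟨fun Y _ => by simp, fun P Q => differentiableOn_const 0⟩ (fun Y _ => analyticAt_const) le_rfl zero_le_one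
    (fun X => by simp) (by norm_num) (by norm_num) (fun B _ => by simp) (fun B _ => by simp) (fun X => by simp)
    (fun B => by simp) (fun X => by simp) (fun Y _ => by simp)
    (fun B hB => by
      rw [starₗᵢ_apply, Complex.star_def] at hB
      simpa using Complex.conj_eq_iff_re.mp hB)
    (fun y => by simp) (fun y => by simp)
    (fun X hX => by
      rw [starₗᵢ_apply, Complex.star_def] at hX
      simpa using Complex.conj_eq_iff_re.mp hX)
    (fun x => by simp)
    (by rw [Complex.ofRealCLM_apply, Complex.norm_real, Real.norm_eq_abs]; norm_num)

end RealJacobian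

/-! ## §2 The Jacobian term along an affine real ray: an SM-L4 analyticity–boundedness pair -/

section RayPair

variable {𝒳 𝒴 : Type*} [NormedAddCommGroup 𝒳] [NormedSpace ℂ 𝒳] [CompleteSpace 𝒳]
  [NormedAddCommGroup 𝒴] [NormedSpace ℂ 𝒴] [CompleteSpace 𝒴] [FiniteDimensional ℂ 𝒴]
  {hop : 𝒳 →ₗ[ℂ] 𝒴} {Ct : 𝒴 → 𝒳} {C₂ R b ε : ℝ} {Dt : 𝒴 → 𝒳}
  {κX : 𝒳 ≃ₗᵢ⋆[ℂ] 𝒳} {κY : 𝒴 ≃ₗᵢ⋆[ℂ] 𝒴}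
variable {E F : Type*} [NormedAddCommGroup E] [NormedSpace ℝ E] [NormedAddCommGroup F] [NormedSpace ℝ F]
  {ιE : E →L[ℝ] 𝒴} {πE : 𝒴 →L[ℝ] E} {ιF : F →L[ℝ] 𝒳} {πF : 𝒳 →L[ℝ] F} {h : F →L[ℝ] E}

omit [CompleteSpace 𝒴] [FiniteDimensional ℂ 𝒴] in
/-- the complexified affine ray `ιE y₀ + w • ιE v`, `‖w‖ < Rad`, stays in the ball of radius
`r ≥ ‖ιE y₀‖ + Rad·‖ιE v‖`. [folklore] -/
theorem norm_ray_le {y₀ v : E} {Rad r : ℝ} (hr : ‖ιE y₀‖ + Rad * ‖ιE v‖ ≤ r) {w : ℂ}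
    (hw : w ∈ ball (0 : ℂ) Rad) : ‖ιE y₀ + w • ιE v‖ ≤ r := by
  rw [mem_ball_zero_iff] at hw
  calc ‖ιE y₀ + w • ιE v‖ ≤ ‖ιE y₀‖ + ‖w‖ * ‖ιE v‖ := (norm_add_le _ _).trans (by rw [norm_smul])
    _ ≤ ‖ιE y₀‖ + Rad * ‖ιE v‖ := by gcongr
    _ ≤ r := hr

/-- **ANALYTICITY ALONG THE RAY**: `w ↦ Tr mlog(1 − J(ιE y₀ + w • ιE v))` is complex differentiable on `‖w‖ < Rad`
whenever `‖ιE y₀‖ + Rad·‖ιE v‖ ≤ r < ε` (`B12JacobianTrLog268.analyticOnNhd_trace_logJacobian` ∘ an affine map) —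
S16 `ShellMeasureRayWiring.rayBound_of_analytic_terms`'s `hg` for the Jacobian term. [folklore] -/
theorem differentiableOn_jacobianTerm_ray (hC : QuadAnalytic Ct C₂ R) (hCa : AnalyticOnNhd ℂ Ct {Y : 𝒴 | ‖Y‖ < R})
    (hC₂ : 0 ≤ C₂) (hb : 0 ≤ b) (hHop : ∀ X, ‖hop X‖ ≤ b * ‖X‖) (hq2 : 9 * C₂ * b * ε ≤ 1 / 2)
    (hRC : 3 * ε ≤ R) (hDball : ∀ B : 𝒴, ‖B‖ < ε → Dt B ∈ closedBall (0:𝒳) (4 * C₂ * ε ^ 2))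
    (hDfix : ∀ B : 𝒴, ‖B‖ < ε → Ct (B - hop (Dt B)) = Dt B)
    {y₀ v : E} {Rad r : ℝ} (hr : ‖ιE y₀‖ + Rad * ‖ιE v‖ ≤ r) (hrε : r < ε) :
    DifferentiableOn ℂ (fun w : ℂ => LinearMap.trace ℂ 𝒴
      ((mlog (1 - hop.mkContinuous b hHop ∘L fderiv ℂ Dt (ιE y₀ + w • ιE v)) : 𝒴 →L[ℂ] 𝒴) : 𝒴 →ₗ[ℂ] 𝒴))
      (ball 0 Rad) := by
  have hA := (analyticOnNhd_trace_logJacobian hC hCa hC₂ hb hHop hq2 hRC hDball hDfix).differentiableOn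
  have haff : Differentiable ℂ (fun w : ℂ => ιE y₀ + w • ιE v) :=
    (differentiable_const _).add (differentiable_id.smul_const _)
  exact hA.comp haff.differentiableOn fun w hw =>
    mem_ball_zero_iff.mpr ((norm_ray_le hr hw).trans_lt hrε)

/-- **SUP BOUND ALONG THE RAY**: `|Tr mlog(1 − J(ιE y₀ + w • ιE v))| ≤ dim_ℂ 𝒴 · (−log(1 − 18C₂b·r))` on
`‖w‖ < Rad` (`B12JacobianTrLog268.norm_trace_logJacobian_le_finrank` + monotonicity of `−log(1 − ·)`). [folklore] -/
theorem norm_jacobianTerm_ray_le (hC : QuadAnalytic Ct C₂ R) (hCa : AnalyticOnNhd ℂ Ct {Y : 𝒴 | ‖Y‖ < R})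
    (hC₂ : 0 ≤ C₂) (hb : 0 ≤ b) (hHop : ∀ X, ‖hop X‖ ≤ b * ‖X‖) (hq2 : 9 * C₂ * b * ε ≤ 1 / 2)
    (hRC : 3 * ε ≤ R) (hDball : ∀ B : 𝒴, ‖B‖ < ε → Dt B ∈ closedBall (0:𝒳) (4 * C₂ * ε ^ 2))
    (hDfix : ∀ B : 𝒴, ‖B‖ < ε → Ct (B - hop (Dt B)) = Dt B)
    {y₀ v : E} {Rad r : ℝ} (hr : ‖ιE y₀‖ + Rad * ‖ιE v‖ ≤ r) (hrε : r < ε)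
    {w : ℂ} (hw : w ∈ ball (0 : ℂ) Rad) :
    ‖LinearMap.trace ℂ 𝒴
        ((mlog (1 - hop.mkContinuous b hHop ∘L fderiv ℂ Dt (ιE y₀ + w • ιE v)) : 𝒴 →L[ℂ] 𝒴) : 𝒴 →ₗ[ℂ] 𝒴)‖ ≤
      Module.finrank ℂ 𝒴 * (-Real.log (1 - 18 * C₂ * b * r)) := by
  have hBr := norm_ray_le hr hw
  have hB : ‖ιE y₀ + w • ιE v‖ < ε := hBr.trans_lt hrε
  refine (norm_trace_logJacobian_le_finrank hC hCa hC₂ hb hHop hq2 hRC hDball hDfix hB).trans ?_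
  refine mul_le_mul_of_nonneg_left (neg_le_neg (Real.log_le_log ?_ ?_)) (Nat.cast_nonneg _)
  · linarith [eighteen_lt_one hC₂ hb hq2 hrε]
  · have : 0 ≤ 18 * C₂ * b := by positivity
    nlinarith

/-- **OSCILLATION BOUND ALONG THE RAY** (S16's `hosc`): `|g w − g 0| ≤ 2·dim_ℂ 𝒴·(−log(1 − 18C₂b·r))`. [folklore] -/
theorem osc_jacobianTerm_ray_le (hC : QuadAnalytic Ct C₂ R) (hCa : AnalyticOnNhd ℂ Ct {Y : 𝒴 | ‖Y‖ < R})
    (hC₂ : 0 ≤ C₂) (hb : 0 ≤ b) (hHop : ∀ X, ‖hop X‖ ≤ b * ‖X‖) (hq2 : 9 * C₂ * b * ε ≤ 1 / 2)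
    (hRC : 3 * ε ≤ R) (hDball : ∀ B : 𝒴, ‖B‖ < ε → Dt B ∈ closedBall (0:𝒳) (4 * C₂ * ε ^ 2))
    (hDfix : ∀ B : 𝒴, ‖B‖ < ε → Ct (B - hop (Dt B)) = Dt B)
    {y₀ v : E} {Rad r : ℝ} (hRad : 0 < Rad) (hr : ‖ιE y₀‖ + Rad * ‖ιE v‖ ≤ r) (hrε : r < ε)
    {w : ℂ} (hw : w ∈ ball (0 : ℂ) Rad) :
    ‖LinearMap.trace ℂ 𝒴
        ((mlog (1 - hop.mkContinuous b hHop ∘L fderiv ℂ Dt (ιE y₀ + w • ιE v)) : 𝒴 →L[ℂ] 𝒴) : 𝒴 →ₗ[ℂ] 𝒴) -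
      LinearMap.trace ℂ 𝒴
        ((mlog (1 - hop.mkContinuous b hHop ∘L fderiv ℂ Dt (ιE y₀ + (0:ℂ) • ιE v)) : 𝒴 →L[ℂ] 𝒴) :
          𝒴 →ₗ[ℂ] 𝒴)‖ ≤
      2 * (Module.finrank ℂ 𝒴 * (-Real.log (1 - 18 * C₂ * b * r))) := by
  refine (norm_sub_le _ _).trans ?_
  have h1 := norm_jacobianTerm_ray_le hC hCa hC₂ hb hHop hq2 hRC hDball hDfix hr hrε hw
  have h0 := norm_jacobianTerm_ray_le hC hCa hC₂ hb hHop hq2 hRC hDball hDfix hr hrε (mem_ball_self hRad)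
  linarith

/-- **REAL PART ALONG THE RAY = LOG OF THE REAL JACOBIAN** (S16's `hreal` for the Jacobian term): at a real
parameter `c`, `Re Tr mlog(1 − J(ιE y₀ + c • ιE v)) = log det (id − h ∘ D̃'_ℝ(y₀ + c • v))`. [folklore] -/
theorem re_jacobianTerm_ray (hC : QuadAnalytic Ct C₂ R) (hCa : AnalyticOnNhd ℂ Ct {Y : 𝒴 | ‖Y‖ < R})
    (hC₂ : 0 ≤ C₂) (hb : 0 ≤ b) (hHop : ∀ X, ‖hop X‖ ≤ b * ‖X‖) (hq2 : 9 * C₂ * b * ε ≤ 1 / 2)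
    (hRC : 3 * ε ≤ R) (hDball : ∀ B : 𝒴, ‖B‖ < ε → Dt B ∈ closedBall (0:𝒳) (4 * C₂ * ε ^ 2))
    (hDfix : ∀ B : 𝒴, ‖B‖ < ε → Ct (B - hop (Dt B)) = Dt B)
    (hκX : ∀ X, κX (κX X) = X) (hκY : ∀ B, κY (κY B) = B)
    (hhop : ∀ X, hop (κX X) = κY (hop X)) (hCt : ∀ Y : 𝒴, ‖Y‖ < R → Ct (κY Y) = κX (Ct Y))
    (hιπE : ∀ B, κY B = B → ιE (πE B) = B) (hιEr : ∀ y, κY (ιE y) = ιE y) (hπιE : ∀ y, πE (ιE y) = y)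
    (hιπF : ∀ X, κX X = X → ιF (πF X) = X) (hh : ∀ x, hop (ιF x) = ιE (h x))
    {y₀ v : E} {c : ℝ} (hc : ‖ιE (y₀ + c • v)‖ < ε) :
    (LinearMap.trace ℂ 𝒴
        ((mlog (1 - hop.mkContinuous b hHop ∘L fderiv ℂ Dt (ιE y₀ + (c:ℂ) • ιE v)) : 𝒴 →L[ℂ] 𝒴) :
          𝒴 →ₗ[ℂ] 𝒴)).re =
      Real.log (ContinuousLinearMap.id ℝ E -
        h ∘L (πF ∘L (fderiv ℂ Dt (ιE (y₀ + c • v))).restrictScalars ℝ ∘L ιE)).det := by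
  have e0 : ιE y₀ + (c:ℂ) • ιE v = ιE (y₀ + c • v) := by rw [Complex.coe_smul, map_add, map_smul]
  rw [e0, det_realForm_phi_eq_exp hC hCa hC₂ hb hHop hq2 hRC hDball hDfix hκX hκY hhop hCt hιπE hιEr hπιE hιπF hh
    hc, Real.log_exp]

end RayPair

/-! ## §3 The END shape: E2′'s SM-L4 ray binder `hE` for the Jacobian term in the fibre coordinate -/

section EndShape

variable {𝒳 𝒴 : Type*} [NormedAddCommGroup 𝒳] [NormedSpace ℂ 𝒳] [CompleteSpace 𝒳]
  [NormedAddCommGroup 𝒴] [NormedSpace ℂ 𝒴] [CompleteSpace 𝒴] [FiniteDimensional ℂ 𝒴]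
  {hop : 𝒳 →ₗ[ℂ] 𝒴} {Ct : 𝒴 → 𝒳} {C₂ R b ε : ℝ} {Dt : 𝒴 → 𝒳}
  {κX : 𝒳 ≃ₗᵢ⋆[ℂ] 𝒳} {κY : 𝒴 ≃ₗᵢ⋆[ℂ] 𝒴}
variable {E F : Type*} [NormedAddCommGroup E] [NormedSpace ℝ E] [NormedAddCommGroup F] [NormedSpace ℝ F]
  {ιE : E →L[ℝ] 𝒴} {πE : 𝒴 →L[ℝ] E} {ιF : F →L[ℝ] 𝒳} {πF : 𝒳 →L[ℝ] F} {h : F →L[ℝ] E}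
  {Kf : Type*} [AddCommGroup Kf] [Module ℝ Kf]

/-- **E2′'s `hE` FOR THE JACOBIAN TERM — THE JACOBIAN'S SHARE OF SM-L4 ON THE (LR)_j ROAD IS A THEOREM.**  In the
fibre coordinate `x : Kf` of S33's curved chart (charted point `y₀ + Λ x`, `y₀` the centre `σ b`, `Λ x = Ψ (x, 0)`
linear), with the Jacobian term `𝓔_J x := −log det (id − h ∘ D̃'_ℝ(y₀ + Λ x))` and a window `W` whose complexified
rays stay in the ball (`‖ιE y₀‖ + Rad·‖ιE (Λ x)‖ ≤ r < ε`, `Rad > 1`): for every `x ∈ W` and `1∕2 ≤ c ≤ 1`,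
`𝓔_J (c • x) ≤ 𝓔_J x + (1 − c) · (3 · (2·dim_ℂ 𝒴·(−log(1 − 18C₂b·r))) ∕ (Rad − 1))` — LITERALLY the binder `hE` of
`ShellMeasureLevelAssembly.slotAntiConcentration_of_levelData` ∕ E2′ ∕ S33's ENDs for this term, by ONE call of S16
`ShellMeasureRayWiring.rayBound_of_analytic` on §2's pair.  Its only inputs are W-d's own data (`h`, `C̃`
quadratic-analytic and conjugation-equivariant, `9C₂bε ≤ 1∕2`, `3ε ≤ R`), the real form and finite dimension: NO new
binder; NOT an instance of SM-L4 for the other (Bałaban's) terms. [folklore] -/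
theorem hE_jacobianTerm (hC : QuadAnalytic Ct C₂ R) (hCa : AnalyticOnNhd ℂ Ct {Y : 𝒴 | ‖Y‖ < R})
    (hC₂ : 0 ≤ C₂) (hb : 0 ≤ b) (hHop : ∀ X, ‖hop X‖ ≤ b * ‖X‖) (hq2 : 9 * C₂ * b * ε ≤ 1 / 2)
    (hRC : 3 * ε ≤ R) (hDball : ∀ B : 𝒴, ‖B‖ < ε → Dt B ∈ closedBall (0:𝒳) (4 * C₂ * ε ^ 2))
    (hDfix : ∀ B : 𝒴, ‖B‖ < ε → Ct (B - hop (Dt B)) = Dt B)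
    (hκX : ∀ X, κX (κX X) = X) (hκY : ∀ B, κY (κY B) = B)
    (hhop : ∀ X, hop (κX X) = κY (hop X)) (hCt : ∀ Y : 𝒴, ‖Y‖ < R → Ct (κY Y) = κX (Ct Y))
    (hιπE : ∀ B, κY B = B → ιE (πE B) = B) (hιEr : ∀ y, κY (ιE y) = ιE y) (hπιE : ∀ y, πE (ιE y) = y)
    (hιπF : ∀ X, κX X = X → ιF (πF X) = X) (hh : ∀ x, hop (ιF x) = ιE (h x))
    (Λ : Kf →ₗ[ℝ] E) (y₀ : E) {W : Set Kf} {Rad r : ℝ} (hRad : 1 < Rad)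
    (hW : ∀ x ∈ W, ‖ιE y₀‖ + Rad * ‖ιE (Λ x)‖ ≤ r) (hrε : r < ε) :
    ∀ x ∈ W, ∀ c : ℝ, 1 / 2 ≤ c → c ≤ 1 →
      (fun x : Kf => -Real.log (ContinuousLinearMap.id ℝ E -
          h ∘L (πF ∘L (fderiv ℂ Dt (ιE (y₀ + Λ x))).restrictScalars ℝ ∘L ιE)).det) (c • x) ≤
        (fun x : Kf => -Real.log (ContinuousLinearMap.id ℝ E -
          h ∘L (πF ∘L (fderiv ℂ Dt (ιE (y₀ + Λ x))).restrictScalars ℝ ∘L ιE)).det) x +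
          (1 - c) * (3 * (2 * (Module.finrank ℂ 𝒴 * (-Real.log (1 - 18 * C₂ * b * r)))) / (Rad - 1)) := by
  have hRad0 : 0 < Rad := by linarith
  refine ShellMeasureRayWiring.rayBound_of_analytic (W := W)
    (𝓔 := fun x : Kf => -Real.log (ContinuousLinearMap.id ℝ E -
      h ∘L (πF ∘L (fderiv ℂ Dt (ιE (y₀ + Λ x))).restrictScalars ℝ ∘L ιE)).det)
    (g := fun x w => -LinearMap.trace ℂ 𝒴
      ((mlog (1 - hop.mkContinuous b hHop ∘L fderiv ℂ Dt (ιE y₀ + w • ιE (Λ x))) : 𝒴 →L[ℂ] 𝒴) : 𝒴 →ₗ[ℂ] 𝒴))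
    hRad (fun x hx => ?_) (fun x hx w hw => ?_) (fun x hx c hc0 hc1 => ?_)
  · exact (differentiableOn_jacobianTerm_ray hC hCa hC₂ hb hHop hq2 hRC hDball hDfix (hW x hx) hrε).neg
  · rw [neg_sub_neg, norm_sub_rev]
    exact osc_jacobianTerm_ray_le hC hCa hC₂ hb hHop hq2 hRC hDball hDfix hRad0 (hW x hx) hrε hw
  · have hcRad : (c : ℂ) ∈ ball (0 : ℂ) Rad := by
      rw [mem_ball_zero_iff, Complex.norm_real, Real.norm_eq_abs, abs_of_nonneg hc0]
      linarith
    have hc : ‖ιE (y₀ + c • Λ x)‖ < ε := by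
      have e0 : ιE (y₀ + c • Λ x) = ιE y₀ + (c:ℂ) • ιE (Λ x) := by rw [Complex.coe_smul, map_add, map_smul]
      rw [e0]
      exact (norm_ray_le (hW x hx) hcRad).trans_lt hrε
    simp only [Complex.neg_re, map_smul]
    rw [re_jacobianTerm_ray hC hCa hC₂ hb hHop hq2 hRC hDball hDfix hκX hκY hhop hCt hιπE hιEr hπιE hιπF hh hc]

omit [CompleteSpace 𝒴] [FiniteDimensional ℂ 𝒴] in
/-- the constant is nonnegative (E2′'s `hB𝓔` for the Jacobian term) when `0 ≤ r`. [folklore] -/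
theorem hB𝓔_jacobianTerm (hC₂ : 0 ≤ C₂) (hb : 0 ≤ b) (hq2 : 9 * C₂ * b * ε ≤ 1 / 2) {Rad r : ℝ} (hRad : 1 < Rad)
    (hr0 : 0 ≤ r) (hrε : r < ε) :
    0 ≤ 3 * (2 * ((Module.finrank ℂ 𝒴 : ℝ) * (-Real.log (1 - 18 * C₂ * b * r)))) / (Rad - 1) := by
  have h1 : 0 ≤ -Real.log (1 - 18 * C₂ * b * r) := by
    rw [neg_nonneg]
    refine Real.log_nonpos ?_ ?_
    · linarith [eighteen_lt_one hC₂ hb hq2 hrε]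
    · have : 0 ≤ 18 * C₂ * b * r := by positivity
      linarith
  have h2 : 0 ≤ 2 * ((Module.finrank ℂ 𝒴 : ℝ) * (-Real.log (1 - 18 * C₂ * b * r))) := by positivity
  exact ShellMeasureRayWiring.rayConst_nonneg hRad h2

end EndShape

end Summit.QuantumFields.BalabanUV.T4Continuum.ShellMeasureLinearizedJacobian

end
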